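import Literature.Topology.FourManifolds.FlipDiffeomorphism
import Literature.Topology.FourManifolds.SlideBasisLoop
import Literature.Topology.FourManifolds.SublevelLoops
import Literature.AlgebraicTopology.FundamentalGroup.FlipTrack
import Mathlib.Analysis.Convex.Contractible
import HarnessLib

/-!
# The flip of a `1`-handle realises `x ↦ u · x⁻¹ · v` on the loop through the handle

Topic `Literature/Topology/FourManifolds` (fact seat
`provefact-Literature.Topology.FourManifolds.lauden-f709dd520c`, Laudenbach–Poénaru's Lemma 2: the
flip `H₂`, "`Φ₂(x₁) = x₁⁻¹`, `Φ₂(xᵢ) = xᵢ`", p. 339).  Everything here is **proved**; no named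
facts.

Let `C` be a flip context (`FlipContext.lean`) compatible with a left-sphere setting `L` of the
critical point `q` of index `1` (`FeetOnLeftHandDisc.lean`: same point, the handle chart has the
coordinates of the box chart, …) whose chart `C.φ` has the coordinates of the box chart, and
let `C_q` be the arc of the handle (an injective path onto the left-hand disc of `q` down to the
level `L.b`), `α₋`, `α₊` paths from a base point `x₀` to its end points, all three below the
seed collar `{f ≤ c - 2τ}`.  Then the flip diffeomorphism `Ψ` of `C`
(`FlipContext.exists_diffeomorph₂`) fixes `{f ≤ c - 2τ}` pointwise and

`Ψ_# [α₋ · C_q · α₊⁻¹] = [u] · [α₋ · C_q · α₊⁻¹]⁻¹ · [v]`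

for two loops `u`, `v` at `x₀` **inside `{f ≤ c - 2τ}`** (`Compat.exists_flip_realise`).
Mechanism: the basis loop is `A₋ · O₁⁻¹ · P₂ · O₃ · A₊⁻¹` (`SlideBasisLoop.mk_arcLoop_eq`) with
`P₂` on the axis of the handle; `Ψ` is the rotation by `π` on the handle region, so it maps the
axis point `discPoint v` to `discPoint (-v)` (`apply_discPoint`), exchanging the feet and
reversing the axis arc up to homotopy inside the (contractible) axis segment; the groupoid
identity `FlipTrack.mapOfEq_mk_arcLoop_of_reverses` gives `u · x⁻¹ · v` with `u`, `v` inside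
`{f ≤ a}` (`Ψ` maps `{f ≤ a}` into itself), and the flow pushes them below the seed collar
(`SlideContext.exists_loop_below`).

## References

* F. Laudenbach, V. Poénaru, *A note on 4-dimensional handlebodies*, Bull. Soc. Math. France
  100 (1972) 337–344, §2, proof of Lemma 2 (pp. 339–340). [LaudenbachPoenaruBSMF1972]
* J. Milnor, *Lectures on the h-cobordism theorem* (1965), Def. 3.9, Thms. 3.4, 3.13.
  [MilnorHCobordism1965]
* A. Hatcher, *Algebraic Topology* (2002), §1.1. [HatcherAT2002]
-/

open scoped Manifold ContDiff Topology unitInterval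
open Set Function Metric

noncomputable section

namespace Literature.Topology.FourManifolds

open BoundaryManifold MorseChartRotate Literature.AlgebraicTopology.FundamentalGroup

universe u

/-! ### The rotation on the axis -/

namespace OneHandleModel

/-- The axis vector `(t, 0, …, 0)` is `consCLE (0, t)`. [folklore] -/
theorem lowerEmb_one_eq_consCLE (n : ℕ) (w : EuclideanSpace ℝ (Fin 1)) :
    lowerEmb 1 (n + 1) w = consCLE n (0, w 0) := by
  ext i
  rw [lowerEmb_apply]
  refine Fin.cases ?_ (fun j => ?_) i
  · simp [consCLE_apply_zero]
  · have : ¬ ((j.succ : ℕ) < 1) := by simp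
    rw [dif_neg this, consCLE_apply_succ]; rfl

/-- **The rotation by `π` reverses the axis**: `r (t, 0, …, 0) = (-t, 0, …, 0)`. [folklore] -/
theorem rotE_lowerEmb {n : ℕ} (hn : 1 ≤ n) (w : EuclideanSpace ℝ (Fin 1)) :
    rotE hn (lowerEmb 1 (n + 1) w) = lowerEmb 1 (n + 1) (-w) := by
  rw [lowerEmb_one_eq_consCLE, rotE_consCLE, map_zero, lowerEmb_one_eq_consCLE]
  rfl

end OneHandleModel

/-! ### The flip on the axis of the handle -/

variable {n : ℕ} {M₀ N₀ : Type u} [TopologicalSpace M₀] [ChartedSpace (EuclideanSpace ℝ (Fin n)) M₀]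
  [TopologicalSpace N₀] [ChartedSpace (EuclideanSpace ℝ (Fin n)) N₀]

namespace Cobordism.LeftSphereSetting.Compat

variable {c : Cobordism n M₀ N₀} {g : c.W → ℝ} {ξ : Π x : c.W, TangentSpace (𝓡∂ (n + 1)) x}
  {L : LeftSphereSetting c g ξ 0} {C : FlipContext n c.W} (h : Compat L C.toSlideContext)
  (hφ : ∀ x, C.φ.extend (𝓡∂ (n + 1)) x = L.box.chart.extend (𝓡∂ (n + 1)) x)
  (hφs : ∀ u, (C.φ.extend (𝓡∂ (n + 1))).symm u = (L.box.chart.extend (𝓡∂ (n + 1))).symm u)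

include h hφ hφs in
/-- **The flip on the axis**: a self-map which is the rotation by `π` in the coordinates of
`C.φ` on the handle region sends the axis point `discPoint v` (`‖v‖ ≤ √m/ε_L`) to
`discPoint (-v)`. [cite: MilnorHCobordism1965, Def. 3.9 (PDF p. 16)] -/
theorem apply_discPoint {Ψ : c.W → c.W}
    (hrot : ∀ x ∈ C.S.N, C.S.f x ≤ C.S.ℓu - 3 * C.S.δ →
      Ψ x = (C.φ.extend (𝓡∂ (n + 1))).symm (rotAt C.hn1 (C.φ.extend (𝓡∂ (n + 1)) C.S.p) (C.φ.extend (𝓡∂ (n + 1)) x)))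
    {v : EuclideanSpace ℝ (Fin 1)} (hv : ‖v‖ ≤ √C.toSlideContext.toCtx.m / L.ε) :
    Ψ (L.discPoint v) = L.discPoint (-v) := by
  have hv1 : ‖v‖ ≤ 1 := hv.trans ((div_le_one L.eps_pos).2 h.sqrt_m_le)
  have hxN : L.discPoint v ∈ C.S.N := (h.discPoint_mem_N hv).1
  have hlev : C.S.f (L.discPoint v) ≤ C.S.ℓu - 3 * C.S.δ := by
    obtain ⟨d, hd⟩ := h.shift
    have h1 : C.S.f (L.discPoint v) = g (L.discPoint v) + d := hd _ hxN.1
    have h2 : C.S.f C.S.p = g L.q + d := by rw [hd _ C.S.D.mem_source, h.hp]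
    have h3 : g (L.discPoint v) ≤ g L.q := by rw [L.apply_discPoint hv1]; nlinarith [L.eps_pos, norm_nonneg v]
    have h4 : C.S.f C.S.p ≤ C.S.ℓu - 3 * C.S.δ := by rw [C.hℓu_eq, C.hδ_eq]; nlinarith [C.S.ε_pos]
    linarith
  rw [hrot _ hxN hlev]
  -- the coordinates of the axis point
  have hw : ‖lowerEmb 1 (n + 1) (L.ε • v)‖ ≤ 3 * L.ε := (L.norm_lowerEmb_smul_lt hv1).le
  have htarget : L.box.chart.extend (𝓡∂ (n + 1)) L.q + lowerEmb 1 (n + 1) (L.ε • v) ∈ (L.box.chart.extend (𝓡∂ (n + 1))).target :=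
    L.box.closedBall_subset (by rw [mem_closedBall, dist_eq_norm, add_sub_cancel_left]; exact hw)
  have hcoord : C.φ.extend (𝓡∂ (n + 1)) (L.discPoint v) = L.box.chart.extend (𝓡∂ (n + 1)) L.q + lowerEmb 1 (n + 1) (L.ε • v) := by
    rw [hφ]; exact (L.box.chart.extend (𝓡∂ (n + 1))).right_inv htarget
  have hcen : C.φ.extend (𝓡∂ (n + 1)) C.S.p = L.box.chart.extend (𝓡∂ (n + 1)) L.q := by rw [hφ, h.hp]
  rw [hcoord, hcen, rotAt, add_sub_cancel_left, OneHandleModel.rotE_lowerEmb, hφs, ← smul_neg]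
  rfl

end Cobordism.LeftSphereSetting.Compat

/-! ### The axis segment is simply connected -/

namespace Cobordism.LeftSphereSetting

variable {c : Cobordism n M₀ N₀} {g : c.W → ℝ} {ξ : Π x : c.W, TangentSpace (𝓡∂ (n + 1)) x} {k : ℕ}
  (L : LeftSphereSetting c g ξ k)

/-- **The top disc `discPoint (B̄(0,1))` is contractible, hence simply connected** (a
homeomorphic image of the closed unit ball). [cite: MilnorHCobordism1965, Def. 3.9 (PDF p. 16)] -/
theorem simplyConnectedSpace_image_discPoint :
    SimplyConnectedSpace ↥(L.discPoint '' closedBall (0 : EuclideanSpace ℝ (Fin (k + 1))) 1) := by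
  set B : Set (EuclideanSpace ℝ (Fin (k + 1))) := closedBall 0 1 with hB
  haveI : CompactSpace B := isCompact_iff_compactSpace.1 (isCompact_closedBall _ _)
  have hcont : Continuous (B.restrict L.discPoint) := continuousOn_iff_continuous_restrict.1 L.continuousOn_discPoint
  have hinj : Injective (B.restrict L.discPoint) := Set.injOn_iff_injective.1 L.injOn_discPoint
  have hemb : Topology.IsClosedEmbedding (B.restrict L.discPoint) := hcont.isClosedEmbedding hinj
  have e : B ≃ₜ ↥(L.discPoint '' B) :=
    hemb.isEmbedding.toHomeomorph.trans (Homeomorph.setCongr (Set.range_restrict _ _))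
  haveI : ContractibleSpace B := Convex.contractibleSpace (convex_closedBall _ _) ⟨0, mem_closedBall_self zero_le_one⟩
  haveI : ContractibleSpace ↥(L.discPoint '' B) := e.symm.contractibleSpace
  infer_instance

end Cobordism.LeftSphereSetting

/-! ### The flip realises `x ↦ u · x⁻¹ · v` -/

namespace Cobordism.LeftSphereSetting.Compat

variable {c : Cobordism n M₀ N₀} {g : c.W → ℝ} {ξ : Π x : c.W, TangentSpace (𝓡∂ (n + 1)) x}
  {L : LeftSphereSetting c g ξ 0} {C : FlipContext n c.W} (h : Compat L C.toSlideContext)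
  (hφ : ∀ x, C.φ.extend (𝓡∂ (n + 1)) x = L.box.chart.extend (𝓡∂ (n + 1)) x)
  (hφs : ∀ u, (C.φ.extend (𝓡∂ (n + 1))).symm u = (L.box.chart.extend (𝓡∂ (n + 1))).symm u)
  {e₀ e₁ : c.W} (Cq : Path e₀ e₁) (hinj : Injective Cq) (hrange : range Cq = leftHandDisc (𝓡∂ (n + 1)) g ξ L.q L.b)
  (hnn : ∀ z, 0 ≤ mlineDeriv (𝓡∂ (n + 1)) C.S.f z (ξ z))
  (hpos : ∀ z, ¬ IsMCriticalPt (𝓡∂ (n + 1)) g z → 0 < mlineDeriv (𝓡∂ (n + 1)) C.S.f z (ξ z))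

include h hφ hφs hinj hrange hnn hpos in
/-- **The flip of the handle realises `x ↦ u · x⁻¹ · v`.**  With the data of the module
docstring (`x₀`, `α₋`, `α₊` below the seed collar), there are a self-diffeomorphism `Ψ` of
`c.W`, the identity on `{f ≤ c - 2τ}`, and loops `u`, `v` at `x₀` inside `{f ≤ c - 2τ}` with
`Ψ_# [α₋ · C_q · α₊⁻¹] = [u] · [α₋ · C_q · α₊⁻¹]⁻¹ · [v]` (concatenation read from left to
right, in `Path.Homotopic.Quotient`). [cite: LaudenbachPoenaruBSMF1972, §2, proof of Lemma 2 (pp. 339–340)]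
[cite: MilnorHCobordism1965, Thm. 3.13] -/
theorem exists_flip_realise {x₀ : c.W} (hx₀ : C.S.f x₀ ≤ C.c - 2 * C.τ) (αm : Path x₀ e₀) (αp : Path x₀ e₁)
    (hαm : ∀ s, C.S.f (αm s) ≤ C.c - 2 * C.τ) (hαp : ∀ s, C.S.f (αp s) ≤ C.c - 2 * C.τ) :
    ∃ (Ψ : c.W ≃ₘ⟮𝓡∂ (n + 1), 𝓡∂ (n + 1)⟯ c.W) (hΨ : Ψ x₀ = x₀),
      (∀ x, C.S.f x ≤ C.c - 2 * C.τ → Ψ x = x) ∧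
      ∃ u v : Path x₀ x₀, (∀ s, C.S.f (u s) ≤ C.c - 2 * C.τ) ∧ (∀ s, C.S.f (v s) ≤ C.c - 2 * C.τ) ∧
        FundamentalGroup.mapOfEq (⟨Ψ, Ψ.continuous⟩ : C(c.W, c.W)) hΨ
            (FundamentalGroup.fromPath (Path.Homotopic.Quotient.mk ((αm.trans Cq).trans αp.symm))) =
          FundamentalGroup.fromPath
            (((Path.Homotopic.Quotient.mk u).trans
              (Path.Homotopic.Quotient.mk ((αm.trans Cq).trans αp.symm)).symm).trans
              (Path.Homotopic.Quotient.mk v)) := by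
  have hτ := C.τ_pos; have hη := C.S.η_pos
  have hc_le : C.c + 8 * C.τ ≤ C.S.a - 24 * C.S.ε ^ 2 := by
    have := C.toCtx.c_le; simpa only [SlideContext.toCtx_c, SlideContext.toCtx_τ, SlideContext.toCtx_S] using this
  have hca : C.c ≤ C.S.a := by linarith [sq_nonneg C.S.ε]
  have he₀ : C.S.f e₀ ≤ C.c := by have := hαm 1; rw [αm.target] at this; linarith
  have he₁ : C.S.f e₁ ≤ C.c := by have := hαp 1; rw [αp.target] at this; linarith
  -- the basis loop, rewritten
  obtain ⟨sg, D₁, D₃, O₁, P₂, O₃, hsg1, hD₁, hD₃, hO₁, hO₃, -, hP₂v, hloop⟩ :=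
    h.mk_arcLoop_eq Cq hinj hrange hnn hpos he₀ he₁ αm αp
  have hsg : sg ^ 2 = 1 := by rcases hsg1 with rfl | rfl <;> norm_num
  have hsg' : (-sg) ^ 2 = 1 := by rw [neg_sq, hsg]
  -- the flip diffeomorphism
  obtain ⟨Ψ, hid, hsub, -, hrot⟩ := C.exists_diffeomorph₂
  have hΨx₀ : Ψ x₀ = x₀ := hid x₀ hx₀
  -- the flip exchanges the feet and reverses the axis
  have hfeet : ∀ {s : ℝ} (hs : s ^ 2 = 1), Ψ (C.S.D.foot s C.toSlideContext.toCtx.m C.toSlideContext.toCtx.ρ 0) =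
      C.S.D.foot (-s) C.toSlideContext.toCtx.m C.toSlideContext.toCtx.ρ 0 := by
    intro s hs
    have hs' : (-s) ^ 2 = 1 := by rw [neg_sq, hs]
    rw [h.foot_eq_discPoint hs, h.foot_eq_discPoint hs', h.apply_discPoint hφ hφs hrot (by rw [norm_axisVec L _ hs])]
    congr 1
    simp only [axisVec, neg_mul, neg_div, neg_smul]
  have hFm : Ψ (C.S.D.foot sg C.toSlideContext.toCtx.m C.toSlideContext.toCtx.ρ 0) =
      C.S.D.foot (-sg) C.toSlideContext.toCtx.m C.toSlideContext.toCtx.ρ 0 := hfeet hsg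
  have hFp : Ψ (C.S.D.foot (-sg) C.toSlideContext.toCtx.m C.toSlideContext.toCtx.ρ 0) =
      C.S.D.foot sg C.toSlideContext.toCtx.m C.toSlideContext.toCtx.ρ 0 := by
    rw [hfeet hsg', neg_neg]
  -- the pieces of the image loop
  set G : C(c.W, c.W) := ⟨Ψ, Ψ.continuous⟩ with hG
  set Am := αm.trans D₁.symm with hAm
  set Ap := αp.trans D₃.symm with hAp
  set Bm : Path x₀ (G (Am 1)) := ((Am.map (map_continuous G)).cast hΨx₀.symm rfl).cast rfl (by rw [Am.target]) with hBm
  set Bp : Path x₀ (G (Ap 1)) := ((Ap.map (map_continuous G)).cast hΨx₀.symm rfl).cast rfl (by rw [Ap.target]) with hBp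
  have hAm1 : Am 1 = C.S.θ (-(C.S.a - C.c), C.S.D.foot sg C.toSlideContext.toCtx.m C.toSlideContext.toCtx.ρ 0) := Am.target
  have hAp1 : Ap 1 = C.S.θ (-(C.S.a - C.c), C.S.D.foot (-sg) C.toSlideContext.toCtx.m C.toSlideContext.toCtx.ρ 0) := Ap.target
  set Q₁ : Path (C.S.D.foot (-sg) C.toSlideContext.toCtx.m C.toSlideContext.toCtx.ρ 0) (G (Am 1)) :=
    (O₁.map (map_continuous G)).cast hFm.symm (by rw [hAm1]) with hQ₁
  set Q₃ : Path (C.S.D.foot sg C.toSlideContext.toCtx.m C.toSlideContext.toCtx.ρ 0) (G (Ap 1)) :=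
    (O₃.map (map_continuous G)).cast hFp.symm (by rw [hAp1]) with hQ₃
  set R : Path (C.S.D.foot (-sg) C.toSlideContext.toCtx.m C.toSlideContext.toCtx.ρ 0)
      (C.S.D.foot sg C.toSlideContext.toCtx.m C.toSlideContext.toCtx.ρ 0) :=
    (P₂.map (map_continuous G)).cast hFm.symm hFp.symm with hR
  -- the axis arc is reversed up to homotopy inside the axis segment
  have hRhom : R.Homotopic P₂.symm := by
    refine FlipTrack.homotopic_of_range_subset_of_simplyConnected L.simplyConnectedSpace_image_discPoint R P₂.symm ?_ ?_
    · rintro _ ⟨s, rfl⟩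
      obtain ⟨v, hv, hvs⟩ := hP₂v s
      have hv1 : ‖v‖ ≤ 1 := hv.trans ((div_le_one L.eps_pos).2 h.sqrt_m_le)
      refine ⟨-v, by rw [mem_closedBall_zero_iff, norm_neg]; exact hv1, ?_⟩
      show L.discPoint (-v) = Ψ (P₂ s)
      rw [← hvs, h.apply_discPoint hφ hφs hrot hv]
    · rintro _ ⟨s, rfl⟩
      obtain ⟨v, hv, hvs⟩ := hP₂v (unitInterval.symm s)
      have hv1 : ‖v‖ ≤ 1 := hv.trans ((div_le_one L.eps_pos).2 h.sqrt_m_le)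
      exact ⟨v, mem_closedBall_zero_iff.2 hv1, hvs⟩
  -- the groupoid identity
  have key := FlipTrack.mapOfEq_mk_arcLoop_of_reverses G hΨx₀ Am Ap O₁ P₂ O₃
    (Bm.cast rfl (by rw [hAm1])) (fun s => rfl) (Bp.cast rfl (by rw [hAp1])) (fun s => rfl)
    (Q₁.cast rfl (by rw [hAm1])) (fun s => rfl) (Q₃.cast rfl (by rw [hAp1])) (fun s => rfl) R (fun s => rfl) hRhom
  -- the two loops `u`, `v` and their levels
  set u : Path x₀ x₀ := ((Bm.cast rfl (by rw [hAm1])).trans (Q₁.cast rfl (by rw [hAm1])).symm).trans (O₃.trans Ap.symm) with hu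
  set v : Path x₀ x₀ := (Am.trans O₁.symm).trans ((Q₃.cast rfl (by rw [hAp1])).trans (Bp.cast rfl (by rw [hAp1])).symm) with hv
  -- levels of the flow lines of the disc centres
  have hfoot : ∀ {s : ℝ} (hs : s ^ 2 = 1), C.S.f (C.S.D.foot s C.toSlideContext.toCtx.m C.toSlideContext.toCtx.ρ 0) = C.S.a :=
    fun hs => apply_f_foot C.toSlideContext hs
  have hlo : C.S.ℓ₁ < C.c := by rw [C.hℓ₁_eq]; linarith
  have hflow : ∀ {s : ℝ} (hs : s ^ 2 = 1) {t : ℝ}, 0 ≤ t → t ≤ C.S.a - C.c →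
      C.S.f (C.S.θ (t, C.S.θ (-(C.S.a - C.c), C.S.D.foot s C.toSlideContext.toCtx.m C.toSlideContext.toCtx.ρ 0))) ≤ C.S.a := by
    intro s hs t ht0 ht1
    have h1 : C.S.f (C.S.θ (-(C.S.a - C.c), C.S.D.foot s C.toSlideContext.toCtx.m C.toSlideContext.toCtx.ρ 0)) = C.c := by
      rw [C.clock _ _ (by rw [hfoot hs]; exact ⟨by linarith, by linarith⟩) (by rw [hfoot hs]; exact ⟨by linarith, by linarith⟩), hfoot hs]
      ring
    rw [C.clock _ _ (by rw [h1]; exact ⟨by linarith, by linarith⟩) (by rw [h1]; exact ⟨by linarith, by linarith⟩), h1]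
    linarith
  have hAmle : ∀ s, C.S.f (Am s) ≤ C.c := fun s => by
    rw [hAm, Path.trans_apply]
    split_ifs
    · exact (hαm _).trans (by linarith)
    · exact hD₁ _
  have hAple : ∀ s, C.S.f (Ap s) ≤ C.c := fun s => by
    rw [hAp, Path.trans_apply]
    split_ifs
    · exact (hαp _).trans (by linarith)
    · exact hD₃ _
  have hO₁le : ∀ s, C.S.f (O₁ s) ≤ C.S.a := fun s => by
    obtain ⟨t, ht0, ht1, hts⟩ := hO₁ s; rw [hts]; exact hflow hsg ht0 ht1
  have hO₃le : ∀ s, C.S.f (O₃ s) ≤ C.S.a := fun s => by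
    obtain ⟨t, ht0, ht1, hts⟩ := hO₃ s; rw [hts]; exact hflow hsg' ht0 ht1
  have hule : ∀ s, C.S.f (u s) ≤ C.S.a := fun s => by
    rw [hu, Path.trans_apply]
    split_ifs
    · rw [Path.trans_apply]
      split_ifs
      · exact hsub _ ((hAmle _).trans hca)
      · exact hsub _ (hO₁le _)
    · rw [Path.trans_apply]
      split_ifs
      · exact hO₃le _
      · exact (hAple _).trans hca
  have hvle : ∀ s, C.S.f (v s) ≤ C.S.a := fun s => by
    rw [hv, Path.trans_apply]
    split_ifs
    · rw [Path.trans_apply]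
      split_ifs
      · exact (hAmle _).trans hca
      · exact hO₁le _
    · rw [Path.trans_apply]
      split_ifs
      · exact hsub _ (hO₃le _)
      · exact hsub _ ((hAple _).trans hca)
  -- push them below the seed collar
  obtain ⟨u', hu', hu'eq⟩ := C.exists_loop_below hx₀ u hule
  obtain ⟨v', hv', hv'eq⟩ := C.exists_loop_below hx₀ v hvle
  refine ⟨Ψ, hΨx₀, hid, u', v', hu', hv', ?_⟩
  rw [hu'eq, hv'eq, hloop]
  exact key

end Cobordism.LeftSphereSetting.Compat

end Literature.Topology.FourManifolds
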